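import Mathlib

/-!
# Gain conversion below an affine Sturm line

Stub `stub_gainConversionAffine` for the crux `HilbertIntegralOverconvergentIsCongruence`
(line Sketch-ideate-r1-k1): the pure real-arithmetic step converting a family of Schwarz-type bounds
below an *affine* Sturm line into a single geometric decay estimate.
A quantity `x ≤ C'` (`C' ≥ 0`) is known to satisfy `x ≤ C' * ρ ^ (M + 1)` for every natural `M` with
`c₀ D + c_t M + c₁ ≤ n` (`0 < ρ < 1`, `c_t > 0`, `c₀, c₁` arbitrary reals, `D ≥ 1`).  We deduce
`x ≤ C' * A ^ D * R⁻¹ ^ n` with constants `A ≥ 1`, `R > 1` depending only on `ρ, c₀, c_t, c₁`;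
concretely `R = ρ ^ (-(1 / c_t))` and `A = ρ ^ (-((|c₀| + |c₁|) / c_t))`.  Proof: let `N` be the least
`M` whose line `c₀ D + c_t M + c₁` exceeds `n`; the bound at `N - 1` (or the trivial bound if `N = 0`)
gives `x ≤ C' * ρ ^ N`, and the defining inequality `n < c₀ D + c_t N + c₁` of `N` together with
`c₀ D + c₁ ≤ (|c₀| + |c₁|) D` gives `ρ ^ N ≤ A ^ D * R⁻¹ ^ n`.
-/

set_option linter.dupNamespace false

noncomputable section

namespace Summit.Langlands.Langlands.Theorems.HilbertIntegralOverconvergentIsCongruence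

-- adapted from `stub_gainConversion` (integer Sturm line) in
-- `CapacityClassicalityHilbertIntegralOverconvergentIsCongruenceStubGainConversion.lean`
/-- **Gain conversion for an affine Sturm line.**  For `0 < ρ < 1`, `c_t > 0` and real `c₀, c₁`
there are real constants `A ≥ 1` and `R > 1` such that: whenever `x ≤ C'` (`C' ≥ 0`) and
`x ≤ C' * ρ ^ (M + 1)` holds for every `M : ℕ` with `c₀ D + c_t M + c₁ ≤ n`, then
`x ≤ C' * A ^ D * R⁻¹ ^ n` (`D ≥ 1`).  One may take `R = ρ ^ (-(1 / c_t))` and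
`A = ρ ^ (-((|c₀| + |c₁|) / c_t))`. -/
theorem stub_gainConversionAffine (ρ : ℝ) (hρ0 : 0 < ρ) (hρ1 : ρ < 1) (c₀ ct c₁ : ℝ) (hct : 0 < ct) :
    ∃ A R : ℝ, 1 ≤ A ∧ 1 < R ∧
      ∀ (D n : ℕ) (x C' : ℝ), 1 ≤ D → 0 ≤ C' → x ≤ C' →
        (∀ M : ℕ, c₀ * D + ct * M + c₁ ≤ n → x ≤ C' * ρ ^ (M + 1)) →
        x ≤ C' * A ^ D * R⁻¹ ^ n := by
  -- the two exponents: `R = ρ ^ (-α)`, `A = ρ ^ (-β)`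
  obtain ⟨α, hα⟩ : ∃ α : ℝ, α = 1 / ct := ⟨_, rfl⟩
  obtain ⟨β, hβ⟩ : ∃ β : ℝ, β = (|c₀| + |c₁|) / ct := ⟨_, rfl⟩
  have hαpos : 0 < α := by
    rw [hα]
    exact div_pos one_pos hct
  have hβnn : 0 ≤ β := by
    rw [hβ]
    exact div_nonneg (add_nonneg (abs_nonneg _) (abs_nonneg _)) hct.le
  refine ⟨ρ ^ (-β), ρ ^ (-α), ?_, ?_, ?_⟩
  · exact Real.one_le_rpow_of_pos_of_le_one_of_nonpos hρ0 hρ1.le (by linarith)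
  · exact Real.one_lt_rpow_of_pos_of_lt_one_of_neg hρ0 hρ1 (by linarith)
  intro D n x C' hD hC' hxC' H
  -- `N` : the least `M` whose affine line exceeds `n`
  obtain ⟨N, hNnot, hNmin⟩ : ∃ N : ℕ, ¬ (c₀ * D + ct * N + c₁ ≤ n) ∧
      ∀ m : ℕ, m < N → c₀ * D + ct * m + c₁ ≤ n := by
    classical
    have hex : ∃ M : ℕ, ¬ (c₀ * D + ct * M + c₁ ≤ n) := by
      obtain ⟨M, hM⟩ := exists_nat_gt ((n - c₀ * D - c₁) / ct)
      refine ⟨M, not_le.mpr ?_⟩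
      rw [div_lt_iff₀ hct] at hM
      linarith
    exact ⟨Nat.find hex, Nat.find_spec hex, fun m hm => not_not.mp (Nat.find_min hex hm)⟩
  -- the bound at `N - 1` (the trivial bound if `N = 0`)
  have hxN : x ≤ C' * ρ ^ N := by
    rcases N with _ | M₀
    · simpa using hxC'
    · exact H M₀ (hNmin M₀ M₀.lt_succ_self)
  -- minimality of `N`, in real form
  have hkey : (n : ℝ) < c₀ * D + ct * N + c₁ := not_le.mp hNnot
  have hD' : (1 : ℝ) ≤ D := by exact_mod_cast hD
  have hbound : c₀ * D + c₁ ≤ (|c₀| + |c₁|) * D := by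
    have h1 : c₀ * D ≤ |c₀| * D := mul_le_mul_of_nonneg_right (le_abs_self _) (by linarith)
    have h2 : c₁ ≤ |c₁| * D := by
      calc c₁ ≤ |c₁| := le_abs_self _
        _ = |c₁| * 1 := (mul_one _).symm
        _ ≤ |c₁| * D := mul_le_mul_of_nonneg_left hD' (abs_nonneg _)
    linarith
  -- comparison of the exponents
  have hexp : α * n - β * D ≤ (N : ℝ) := by
    have e : α * n - β * D = (n - (|c₀| + |c₁|) * D) / ct := by
      rw [hα, hβ]
      field_simp
    rw [e, div_le_iff₀ hct]
    nlinarith [hkey, hbound]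
  -- `A ^ D * R⁻¹ ^ n = ρ ^ (α n - β D)`
  have hA : (ρ ^ (-β)) ^ D = ρ ^ (-β * D) := by
    rw [← Real.rpow_natCast, ← Real.rpow_mul hρ0.le]
  have hR : (ρ ^ (-α))⁻¹ ^ n = ρ ^ (α * n) := by
    rw [Real.rpow_neg hρ0.le, inv_inv, ← Real.rpow_natCast, ← Real.rpow_mul hρ0.le]
  have hprod : (ρ ^ (-β)) ^ D * (ρ ^ (-α))⁻¹ ^ n = ρ ^ (α * n - β * D) := by
    rw [hA, hR, ← Real.rpow_add hρ0]
    congr 1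
    ring
  calc x ≤ C' * ρ ^ N := hxN
    _ = C' * ρ ^ (N : ℝ) := by rw [Real.rpow_natCast]
    _ ≤ C' * ρ ^ (α * n - β * D) :=
        mul_le_mul_of_nonneg_left (Real.rpow_le_rpow_of_exponent_ge hρ0 hρ1.le hexp) hC'
    _ = C' * (ρ ^ (-β)) ^ D * (ρ ^ (-α))⁻¹ ^ n := by rw [mul_assoc, hprod]

end Summit.Langlands.Langlands.Theorems.HilbertIntegralOverconvergentIsCongruence

end
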